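import Mathlib
import HarnessLib
import Summits.HubbardSuperconductivity.HubbardSuperconductivity.Theorems.KLProgrammeKLRegimeSplitThermalLayerSharpZS

/-!
# Route `KLProgramme` — ENGINE stmt-HubbardSuperconductivity-20437 `KLRegimeEngineV17F2`, row (c) value lane / class-#5 STEP (X).3 pinned pair: THE SHARP ZERO-SOUND CONSTANT
# WITH A QUASI-LIPSCHITZ INSERTION (brick (L3)-1 of cure (A″) route 3′ of located «(c)-OUT-COOPER-ANTIPODE»; cell gate-hubbard-kl, seat hubbard-kl-k3c2-p2 g26,
# technique «thermal-bar induction n ≤ nScales β + 1 with EngineBoundsAtV4S sums»; sequel of …SplitThermalLayerSharpZS (g22) and …MatsubaraZeroSoundWeightedQuasi (g25))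

WHY.  The member rows of record (…MemberPHSignedRowSharpTC → …DLineEdgeSplit3(Door)SharpTC) use the SHARP zero-sound term `(64/π)·M_F·L_W·Λₙ` of
`klte_slice_bubble_weighted_norm_le_sharp`, which asks the e-insertion `W` to be Lipschitz at `e = 0`.  On route 3′ (CELL-SIGNATURES.md §G) the planar vertex weight is the
GLOBAL McShane extension of lattice pins and a CELL of lattice data gives only a QUASI-Lipschitz datum `‖W e − W 0‖ ≤ L_W|e| + δ_W` (`δ_W ∝ (K_g + L_c)/L`).  The sharp
first-order estimate tolerates the defect at the price `δ_W × sup_s ‖G(s)‖·s × (box area)`: with `‖F(s)‖/s ≤ M_F/r₁²` on the annulus the scale form gains the SCALE-FREE term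
**`(128/π)·M_F·δ_W`** (booked in the lattice slot `¼Q.CL β n/L` downstream).
* §1 `klzw_norm_integrand_sub_le_pt_quasi`, **`klzw_integral_plane_weighted_norm_le_pt_quasi`** (`≤ 4r²·(K·L_W + K'·δ_W)` under `‖G(s)‖·s·|e| ≤ K`, `‖G(s)‖·s ≤ K'`),
  **`klzw_discrete_weighted_bubble_norm_le_pt_quasi`**;
* §2 `klte_div_sq_weight_sup_pt` (`K' = M_F/r₁²`), **`klte_annulus_weighted_bubble_norm_le_pt_quasi`**, **`klte_slice_bubble_weighted_norm_le_sharp_quasi`**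
  (`(64/π)·M_F·L_W·Λₙ + (128/π)·M_F·δ_W + (393216/π)·(ℓ+8M_F)·B_W·(π/β)/Λₙ`).
`δ_W = 0` recovers the g22 lemmas.  Pure analysis on the tree's objects; nothing about the model is asserted; nothing asserts (X).3, (c), K3 or superconductivity.
References: BGM 2006 §2.5 (2.56a)–(2.56e) [cite: BenfattoGiulianiMastropietro2006].  0 kit · 0 lit.
-/

noncomputable section

namespace Summit.HubbardSuperconductivity.HubbardSuperconductivity.Theorems.KLRegimeSplit

set_option linter.dupNamespace false -- summit = problem name (single-conjunct summit), D-0017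

open Real Finset MeasureTheory Complex Literature.MathematicalPhysics.QuantumLattice Literature.Probability.LatticeModels
open Summit.HubbardSuperconductivity.HubbardSuperconductivity.Theorems
open Summit.HubbardSuperconductivity.HubbardSuperconductivity.Theorems.KLProgrammeLegKernels

/-! ## §1 The continuum and discrete weighted bubble under a POINTWISE weight bound, quasi-Lipschitz insertion -/

section Weighted

variable {G : ℝ → ℂ} {L r K K' : ℝ} {W : ℝ → ℂ} {LW BW δW : ℝ}

/-- **Sharp first-order pointwise bound, quasi-Lipschitz insertion**: if `‖G(s)‖·s·|e| ≤ K`, `‖G(s)‖·s ≤ K'` (`s = k₀²+e²`), `G(s) = 0` for `s ≥ r²` and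
`‖W(e) − W(0)‖ ≤ L_W|e| + δ_W` on `|e| < r`, then `‖Ψ_G(k₀,e)·(W(e) − W(0))‖ ≤ K·L_W + K'·δ_W` everywhere. -/
theorem klzw_norm_integrand_sub_le_pt_quasi (hsupp : ∀ s, r ^ 2 ≤ s → G s = 0) (hr : 0 < r) (hLW : 0 ≤ LW) (hδW : 0 ≤ δW)
    (hWlip : ∀ e : ℝ, |e| < r → ‖W e - W 0‖ ≤ LW * |e| + δW) (hK0 : 0 ≤ K)
    (hK : ∀ k₀ e : ℝ, ‖G (k₀ ^ 2 + e ^ 2)‖ * (k₀ ^ 2 + e ^ 2) * |e| ≤ K) (hK'0 : 0 ≤ K')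
    (hK' : ∀ k₀ e : ℝ, ‖G (k₀ ^ 2 + e ^ 2)‖ * (k₀ ^ 2 + e ^ 2) ≤ K') (k₀ e : ℝ) :
    ‖G (k₀ ^ 2 + e ^ 2) * (I * k₀ + e) ^ 2 * (W e - W 0)‖ ≤ K * LW + K' * δW := by
  rcases lt_or_ge (k₀ ^ 2 + e ^ 2) (r ^ 2) with hs | hs
  · have he : |e| < r := by nlinarith [sq_abs e, sq_nonneg k₀, abs_nonneg e]
    rw [norm_mul, norm_mul, klzd_norm_lin_sq]
    have hG0 : 0 ≤ ‖G (k₀ ^ 2 + e ^ 2)‖ * (k₀ ^ 2 + e ^ 2) := by positivity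
    calc ‖G (k₀ ^ 2 + e ^ 2)‖ * (k₀ ^ 2 + e ^ 2) * ‖W e - W 0‖
        ≤ ‖G (k₀ ^ 2 + e ^ 2)‖ * (k₀ ^ 2 + e ^ 2) * (LW * |e| + δW) := mul_le_mul_of_nonneg_left (hWlip e he) hG0
      _ = ‖G (k₀ ^ 2 + e ^ 2)‖ * (k₀ ^ 2 + e ^ 2) * |e| * LW + ‖G (k₀ ^ 2 + e ^ 2)‖ * (k₀ ^ 2 + e ^ 2) * δW := by ring
      _ ≤ K * LW + K' * δW := add_le_add (mul_le_mul_of_nonneg_right (hK k₀ e) hLW) (mul_le_mul_of_nonneg_right (hK' k₀ e) hδW)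
  · rw [hsupp _ hs, zero_mul, zero_mul, norm_zero]; positivity

/-- **First-order cancellation in the continuum, sharp form, quasi-Lipschitz insertion**: `‖∫∫ G(k₀²+e²)(ik₀+e)²·W(e)‖ ≤ 4r²·(K·L_W + K'·δ_W)`. -/
theorem klzw_integral_plane_weighted_norm_le_pt_quasi (hlip : ∀ s s', ‖G s - G s'‖ ≤ L * |s - s'|) (hsupp : ∀ s, r ^ 2 ≤ s → G s = 0)
    (hr : 0 < r) (hW : Continuous W) (hLW : 0 ≤ LW) (hδW : 0 ≤ δW) (hWlip : ∀ e : ℝ, |e| < r → ‖W e - W 0‖ ≤ LW * |e| + δW)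
    (hK0 : 0 ≤ K) (hK : ∀ k₀ e : ℝ, ‖G (k₀ ^ 2 + e ^ 2)‖ * (k₀ ^ 2 + e ^ 2) * |e| ≤ K)
    (hK'0 : 0 ≤ K') (hK' : ∀ k₀ e : ℝ, ‖G (k₀ ^ 2 + e ^ 2)‖ * (k₀ ^ 2 + e ^ 2) ≤ K') :
    ‖∫ p : ℝ × ℝ, G (p.1 ^ 2 + p.2 ^ 2) * (I * p.1 + p.2) ^ 2 * W p.2‖ ≤ 4 * r ^ 2 * (K * LW + K' * δW) := by
  have hΨ : Continuous fun p : ℝ × ℝ => G (p.1 ^ 2 + p.2 ^ 2) * (I * p.1 + p.2) ^ 2 := klzd_continuous hlip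
  have hsuppK : ∀ (c : ℝ × ℝ → ℂ), HasCompactSupport fun p : ℝ × ℝ => G (p.1 ^ 2 + p.2 ^ 2) * (I * p.1 + p.2) ^ 2 * c p := by
    intro c
    refine HasCompactSupport.intro ((isCompact_Icc (a := -r) (b := r)).prod (isCompact_Icc (a := -r) (b := r))) fun p hp => ?_
    exact klzw_integrand_zero_of_not_mem hsupp hr.le hp (c p)
  have hI1 : Integrable fun p : ℝ × ℝ => G (p.1 ^ 2 + p.2 ^ 2) * (I * p.1 + p.2) ^ 2 * (W p.2 - W 0) :=
    (hΨ.mul ((hW.comp continuous_snd).sub continuous_const)).integrable_of_hasCompactSupport (hsuppK fun p => W p.2 - W 0)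
  have hI2 : Integrable fun p : ℝ × ℝ => G (p.1 ^ 2 + p.2 ^ 2) * (I * p.1 + p.2) ^ 2 * W 0 :=
    (hΨ.mul continuous_const).integrable_of_hasCompactSupport (hsuppK fun _ => W 0)
  have hsplit : (fun p : ℝ × ℝ => G (p.1 ^ 2 + p.2 ^ 2) * (I * p.1 + p.2) ^ 2 * W p.2) =
      fun p => G (p.1 ^ 2 + p.2 ^ 2) * (I * p.1 + p.2) ^ 2 * (W p.2 - W 0) + G (p.1 ^ 2 + p.2 ^ 2) * (I * p.1 + p.2) ^ 2 * W 0 := by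
    funext p; ring
  rw [hsplit, integral_add hI1 hI2, integral_mul_const, klzd_integral_plane_eq_zero G, zero_mul, add_zero]
  set c : ℝ := K * LW + K' * δW with hc
  have hbound : ∀ p : ℝ × ℝ, ‖G (p.1 ^ 2 + p.2 ^ 2) * (I * p.1 + p.2) ^ 2 * (W p.2 - W 0)‖ ≤
      Set.indicator (Set.Icc (-r) r ×ˢ Set.Icc (-r) r) (fun _ => c) p := by
    intro p
    by_cases hp : p ∈ Set.Icc (-r) r ×ˢ Set.Icc (-r) r
    · rw [Set.indicator_of_mem hp]
      exact klzw_norm_integrand_sub_le_pt_quasi hsupp hr hLW hδW hWlip hK0 hK hK'0 hK' p.1 p.2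
    · rw [Set.indicator_of_notMem hp, klzw_integrand_zero_of_not_mem hsupp hr.le hp, norm_zero]
  have hmeas : MeasurableSet (Set.Icc (-r) r ×ˢ Set.Icc (-r) r : Set (ℝ × ℝ)) := measurableSet_Icc.prod measurableSet_Icc
  have hfin : (volume : Measure (ℝ × ℝ)) (Set.Icc (-r) r ×ˢ Set.Icc (-r) r) ≠ ⊤ := by
    rw [klzw_volume_box r]; exact ENNReal.mul_ne_top ENNReal.ofReal_ne_top ENNReal.ofReal_ne_top
  have hind : Integrable (Set.indicator (Set.Icc (-r) r ×ˢ Set.Icc (-r) r) (fun _ : ℝ × ℝ => c)) :=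
    IntegrableOn.integrable_indicator (integrableOn_const (hs := hfin)) hmeas
  calc ‖∫ p : ℝ × ℝ, G (p.1 ^ 2 + p.2 ^ 2) * (I * p.1 + p.2) ^ 2 * (W p.2 - W 0)‖
      ≤ ∫ p : ℝ × ℝ, Set.indicator (Set.Icc (-r) r ×ˢ Set.Icc (-r) r) (fun _ => c) p :=
        norm_integral_le_of_norm_le hind (Filter.Eventually.of_forall hbound)
    _ = ((volume : Measure (ℝ × ℝ)) (Set.Icc (-r) r ×ˢ Set.Icc (-r) r)).toReal * c := by
        rw [integral_indicator_const _ hmeas, smul_eq_mul, Measure.real]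
    _ = (2 * r) * (2 * r) * c := by
        rw [klzw_volume_box r, ENNReal.toReal_mul, ENNReal.toReal_ofReal (by linarith)]
    _ = 4 * r ^ 2 * (K * LW + K' * δW) := by rw [hc]; ring

/-- **The weighted zero-sound bubble at finite temperature, sharp zero-sound term, quasi-Lipschitz insertion**:
`‖β⁻¹ • Σ_i ∫ G(ω_i² + e²)(iω_i + e)² W(e) de‖ ≤ (2π)⁻¹·4r²·(K·L_W + K'·δ_W) + 8·L·B_W·r⁴·(r + 2π/β)/β`. -/
theorem klzw_discrete_weighted_bubble_norm_le_pt_quasi (hlip : ∀ s s', ‖G s - G s'‖ ≤ L * |s - s'|)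
    (hsupp : ∀ s, r ^ 2 ≤ s → G s = 0) (hr : 0 < r) (hW : Continuous W) (hLW : 0 ≤ LW) (hδW : 0 ≤ δW) (hBW : 0 ≤ BW)
    (hWlip : ∀ e : ℝ, |e| < r → ‖W e - W 0‖ ≤ LW * |e| + δW) (hWbd : ∀ e : ℝ, |e| < r → ‖W e‖ ≤ BW) (hK0 : 0 ≤ K)
    (hK : ∀ k₀ e : ℝ, ‖G (k₀ ^ 2 + e ^ 2)‖ * (k₀ ^ 2 + e ^ 2) * |e| ≤ K)
    (hK'0 : 0 ≤ K') (hK' : ∀ k₀ e : ℝ, ‖G (k₀ ^ 2 + e ^ 2)‖ * (k₀ ^ 2 + e ^ 2) ≤ K')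
    {β : ℝ} (hβ : 0 < β) {M : ℕ} (hM : β * r / (2 * Real.pi) + 1 ≤ M) :
    ‖β⁻¹ • ∑ i : MatsubaraIdx M,
        ∫ e : ℝ, G (matsubaraFreq β M i ^ 2 + e ^ 2) * (I * (matsubaraFreq β M i) + e) ^ 2 * W e‖ ≤
      (2 * Real.pi)⁻¹ * (4 * r ^ 2 * (K * LW + K' * δW)) + 8 * L * BW * r ^ 4 * (r + 2 * Real.pi / β) / β := by
  have hL : 0 ≤ L := by
    have := hlip 0 1; have h0 : (0:ℝ) ≤ ‖G 0 - G 1‖ := norm_nonneg _; norm_num at this; linarith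
  set g : ℝ → ℂ := fun k₀ => ∫ e : ℝ, G (k₀ ^ 2 + e ^ 2) * (I * k₀ + e) ^ 2 * W e with hg
  have hD : 0 ≤ 8 * L * BW * r ^ 4 := by positivity
  have hglip : ∀ t t', ‖g t - g t'‖ ≤ 8 * L * BW * r ^ 4 * |t - t'| := fun t t' =>
    klzw_freqFn_lipschitz hlip hsupp hr hW hBW hWbd t t'
  have hgsupp : ∀ t, r ≤ |t| → g t = 0 := fun t ht => klzw_freqFn_zero hsupp hr.le ht
  have h1 := klmr_matsubara_sum_sub_integral_norm_le hD hglip hr.le hgsupp hβ hM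
  have h2 : ‖(2 * Real.pi)⁻¹ • ∫ t, g t‖ ≤ (2 * Real.pi)⁻¹ * (4 * r ^ 2 * (K * LW + K' * δW)) := by
    rw [norm_smul, Real.norm_of_nonneg (by positivity), hg, klzw_integral_freqFn_eq hlip hsupp hr.le hW]
    exact mul_le_mul_of_nonneg_left (klzw_integral_plane_weighted_norm_le_pt_quasi hlip hsupp hr hW hLW hδW hWlip hK0 hK hK'0 hK')
      (by positivity)
  calc ‖β⁻¹ • ∑ i : MatsubaraIdx M, g (matsubaraFreq β M i)‖
      = ‖(β⁻¹ • ∑ i : MatsubaraIdx M, g (matsubaraFreq β M i) - (2 * Real.pi)⁻¹ • ∫ t, g t) + (2 * Real.pi)⁻¹ • ∫ t, g t‖ := by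
        rw [sub_add_cancel]
    _ ≤ ‖β⁻¹ • ∑ i : MatsubaraIdx M, g (matsubaraFreq β M i) - (2 * Real.pi)⁻¹ • ∫ t, g t‖ + ‖(2 * Real.pi)⁻¹ • ∫ t, g t‖ :=
        norm_add_le _ _
    _ ≤ 8 * L * BW * r ^ 4 * (r + 2 * Real.pi / β) / β + (2 * Real.pi)⁻¹ * (4 * r ^ 2 * (K * LW + K' * δW)) := add_le_add h1 h2
    _ = (2 * Real.pi)⁻¹ * (4 * r ^ 2 * (K * LW + K' * δW)) + 8 * L * BW * r ^ 4 * (r + 2 * Real.pi / β) / β := by ring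

end Weighted

/-! ## §2 The annulus form and the scale form with the sharp zero-sound term, quasi-Lipschitz insertion -/

section SliceBubble

variable {F : ℝ → ℂ} {LF MF ℓ : ℝ} {W : ℝ → ℂ} {LW BW δW : ℝ}

/-- **The pointwise SUP weight bound for `G = F/s²` on the annulus**: if `‖F‖ ≤ M_F` and `F(s) = 0` for `s ≤ r₁²` (`r₁ > 0`), then `‖F(s)/s²‖·s ≤ M_F/r₁²` for
`s = k₀² + e²` (`‖F(s)‖/s ≤ M_F/s ≤ M_F/r₁²` on the support). -/
theorem klte_div_sq_weight_sup_pt {r₁ : ℝ} (hbd : ∀ s, ‖F s‖ ≤ MF) (hin : ∀ s, s ≤ r₁ ^ 2 → F s = 0) (hr₁ : 0 < r₁) (k₀ e : ℝ) :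
    ‖F (k₀ ^ 2 + e ^ 2) / (((k₀ ^ 2 + e ^ 2 : ℝ)) : ℂ) ^ 2‖ * (k₀ ^ 2 + e ^ 2) ≤ MF / r₁ ^ 2 := by
  have hMF : 0 ≤ MF := (norm_nonneg _).trans (hbd 0)
  set s : ℝ := k₀ ^ 2 + e ^ 2 with hs_def
  rcases le_or_gt s (r₁ ^ 2) with hs | hs
  · rw [hin s hs, zero_div, norm_zero, zero_mul]; positivity
  · have hs0 : 0 < s := lt_of_le_of_lt (by positivity) hs
    have hnorm : ‖F s / ((s : ℝ) : ℂ) ^ 2‖ = ‖F s‖ / s ^ 2 := by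
      rw [norm_div, norm_pow, Complex.norm_real, Real.norm_of_nonneg hs0.le]
    rw [hnorm]
    have h1 : ‖F s‖ / s ^ 2 * s = ‖F s‖ / s := by
      field_simp
    rw [h1, div_le_div_iff₀ hs0 (by positivity)]
    exact mul_le_mul (hbd s) hs.le (by positivity) hMF

/-- **The weighted discrete bubble in the carrier's variables, sharp zero-sound term, quasi-Lipschitz insertion** (annulus form of
`klzw_discrete_weighted_bubble_norm_le_pt_quasi`): `‖β⁻¹ • Σ_i ∫ F(ω_i² + e²)·((−iω_i + e)²)⁻¹·W(e) de‖ ≤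
(2π)⁻¹·4r₂²·((M_F/r₁)·L_W + (M_F/r₁²)·δ_W) + 8·L_G·B_W·r₂⁴·(r₂ + 2π/β)/β`, `L_G = L_F/r₁⁴ + 2M_F/r₁⁶`. -/
theorem klte_annulus_weighted_bubble_norm_le_pt_quasi {r₁ r₂ : ℝ} (hlip : ∀ s s', ‖F s - F s'‖ ≤ LF * |s - s'|) (hbd : ∀ s, ‖F s‖ ≤ MF)
    (hin : ∀ s, s ≤ r₁ ^ 2 → F s = 0) (hout : ∀ s, r₂ ^ 2 ≤ s → F s = 0) (hr₁ : 0 < r₁) (hr₂ : 0 < r₂)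
    (hW : Continuous W) (hLW : 0 ≤ LW) (hδW : 0 ≤ δW) (hBW : 0 ≤ BW)
    (hWlip : ∀ e : ℝ, |e| < r₂ → ‖W e - W 0‖ ≤ LW * |e| + δW) (hWbd : ∀ e : ℝ, |e| < r₂ → ‖W e‖ ≤ BW)
    {β : ℝ} (hβ : 0 < β) {M : ℕ} (hM : β * r₂ / (2 * Real.pi) + 1 ≤ M) :
    ‖β⁻¹ • ∑ i : MatsubaraIdx M,
        ∫ e : ℝ, F (matsubaraFreq β M i ^ 2 + e ^ 2) * ((-I * (matsubaraFreq β M i) + e) ^ 2)⁻¹ * W e‖ ≤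
      (2 * Real.pi)⁻¹ * (4 * r₂ ^ 2 * ((MF / r₁) * LW + (MF / r₁ ^ 2) * δW)) +
        8 * (LF / r₁ ^ 4 + 2 * MF / r₁ ^ 6) * BW * r₂ ^ 4 * (r₂ + 2 * Real.pi / β) / β := by
  have hMF : 0 ≤ MF := (norm_nonneg _).trans (hbd 0)
  set G : ℝ → ℂ := fun s => F s / ((s : ℝ) : ℂ) ^ 2 with hG
  have hGlip : ∀ s s', ‖G s - G s'‖ ≤ (LF / r₁ ^ 4 + 2 * MF / r₁ ^ 6) * |s - s'| := fun s s' =>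
    klza_div_sq_lipschitz hlip hbd hin hr₁ s s'
  have hGsupp : ∀ s, r₂ ^ 2 ≤ s → G s = 0 := fun s hs => by simp only [hG, hout s hs, zero_div]
  have hGK : ∀ k₀ e : ℝ, ‖G (k₀ ^ 2 + e ^ 2)‖ * (k₀ ^ 2 + e ^ 2) * |e| ≤ MF / r₁ := fun k₀ e => by
    simp only [hG]
    exact klte_div_sq_weight_pt hbd hin hr₁ k₀ e
  have hGK' : ∀ k₀ e : ℝ, ‖G (k₀ ^ 2 + e ^ 2)‖ * (k₀ ^ 2 + e ^ 2) ≤ MF / r₁ ^ 2 := fun k₀ e => by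
    simp only [hG]
    exact klte_div_sq_weight_sup_pt hbd hin hr₁ k₀ e
  have hconv : ∀ (k₀ e : ℝ), F (k₀ ^ 2 + e ^ 2) * ((-I * k₀ + e) ^ 2)⁻¹ = G (k₀ ^ 2 + e ^ 2) * (I * k₀ + e) ^ 2 := by
    intro k₀ e
    rw [klzd_integrand_eq G k₀ e]
    congr 1
    simp only [hG]
    by_cases hz : ((k₀ ^ 2 + e ^ 2 : ℝ) : ℂ) = 0
    · have hz' : k₀ ^ 2 + e ^ 2 = 0 := by exact_mod_cast hz
      have hk : k₀ = 0 := by nlinarith [sq_nonneg k₀, sq_nonneg e]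
      have he : e = 0 := by nlinarith [sq_nonneg k₀, sq_nonneg e]
      subst hk; subst he
      have : F 0 = 0 := hin 0 (by positivity)
      simp [this]
    · field_simp
  simp_rw [hconv]
  exact klzw_discrete_weighted_bubble_norm_le_pt_quasi hGlip hGsupp hr₂ hW hLW hδW hBW hWlip hWbd (by positivity) hGK (by positivity) hGK' hβ hM

/-- **The same-slice zero-transfer particle–hole bubble with a QUASI-LIPSCHITZ insertion, in scale form, SHARP zero-sound term.**  As
`klte_slice_bubble_weighted_norm_le_sharp` with `‖W(e) − W(0)‖ ≤ L_W|e| + δ_W` for `|e| < 4Λₙ` (`0 ≤ L_W, δ_W, B_W`):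
`‖β⁻¹ • Σ_i ∫ F(ω_i² + e²)·((−iω_i + e)²)⁻¹·W(e) de‖ ≤ (64/π)·M_F·L_W·Λₙ + (128/π)·M_F·δ_W + (393216/π)·(ℓ + 8M_F)·B_W·(π/β)/Λₙ` —
the defect term is SCALE-FREE. -/
theorem klte_slice_bubble_weighted_norm_le_sharp_quasi (hMF : 0 ≤ MF) (hlip : ∀ s s', ‖F s - F s'‖ ≤ LF * |s - s'|) (hbd : ∀ s, ‖F s‖ ≤ MF)
    {n : ℕ} (hLF : LF ≤ ℓ / klScale klE0 n ^ 2)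
    (hin : ∀ s, s ≤ (klScale klE0 n / 2) ^ 2 → F s = 0) (hout : ∀ s, (4 * klScale klE0 n) ^ 2 ≤ s → F s = 0)
    (hW : Continuous W) (hLW : 0 ≤ LW) (hδW : 0 ≤ δW) (hBW : 0 ≤ BW)
    (hWlip : ∀ e : ℝ, |e| < 4 * klScale klE0 n → ‖W e - W 0‖ ≤ LW * |e| + δW)
    (hWbd : ∀ e : ℝ, |e| < 4 * klScale klE0 n → ‖W e‖ ≤ BW)
    {β : ℝ} (hβ : klBetaMin ≤ β) (hn : n ≤ nScales β + 1) {M : ℕ}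
    (hM : β * (4 * klScale klE0 n) / (2 * Real.pi) + 1 ≤ M) :
    ‖β⁻¹ • ∑ i : MatsubaraIdx M,
        ∫ e : ℝ, F (matsubaraFreq β M i ^ 2 + e ^ 2) * ((-I * (matsubaraFreq β M i) + e) ^ 2)⁻¹ * W e‖ ≤
      64 / Real.pi * MF * LW * klScale klE0 n + 128 / Real.pi * MF * δW +
        393216 / Real.pi * (ℓ + 8 * MF) * BW * ((Real.pi / β) / klScale klE0 n) := by
  set Λ := klScale klE0 n with hΛdef
  have hΛ : 0 < Λ := klth_klScale_pos n
  have hβ0 : 0 < β := pos_of_klBetaMin_le hβ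
  have h0 := klte_annulus_weighted_bubble_norm_le_pt_quasi hlip hbd hin hout (by positivity : 0 < Λ / 2) (by positivity : 0 < 4 * Λ)
    hW hLW hδW hBW hWlip hWbd hβ0 hM
  refine h0.trans ?_
  have hLG := klte_LG_le (ℓ := ℓ) (MF := MF) hΛ hLF
  have hℓ : 0 ≤ ℓ := by
    have hLF0 : 0 ≤ LF := by
      have := hlip 0 1; have h0' : (0:ℝ) ≤ ‖F 0 - F 1‖ := norm_nonneg _; norm_num at this; linarith
    have : 0 ≤ ℓ / Λ ^ 2 := hLF0.trans hLF
    rwa [le_div_iff₀ (by positivity), zero_mul] at this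
  have hK : 0 ≤ ℓ + 8 * MF := by positivity
  have hmesh : 4 * Λ + 2 * Real.pi / β ≤ 12 * Λ := by
    have := klte_two_pi_div_le_eight_mul_klScale hβ hn
    rw [← hΛdef] at this
    linarith
  -- first term: `(2π)⁻¹·4·(4Λ)²·((M_F/(Λ/2))·L_W + (M_F/(Λ/2)²)·δ_W) = (64/π)·M_F·L_W·Λ + (128/π)·M_F·δ_W`
  have h1 : (2 * Real.pi)⁻¹ * (4 * (4 * Λ) ^ 2 * ((MF / (Λ / 2)) * LW + (MF / (Λ / 2) ^ 2) * δW)) =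
      64 / Real.pi * MF * LW * Λ + 128 / Real.pi * MF * δW := by
    field_simp
    ring
  have h2 : 8 * (LF / (Λ / 2) ^ 4 + 2 * MF / (Λ / 2) ^ 6) * BW * (4 * Λ) ^ 4 * (4 * Λ + 2 * Real.pi / β) / β ≤
      393216 / Real.pi * (ℓ + 8 * MF) * BW * ((Real.pi / β) / Λ) := by
    have hstep : 8 * (LF / (Λ / 2) ^ 4 + 2 * MF / (Λ / 2) ^ 6) * BW * (4 * Λ) ^ 4 * (4 * Λ + 2 * Real.pi / β) ≤
        8 * (16 * (ℓ + 8 * MF) / Λ ^ 6) * BW * (4 * Λ) ^ 4 * (12 * Λ) := by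
      have h44 : 0 ≤ (4 * Λ) ^ 4 := by positivity
      have hm0 : 0 ≤ 4 * Λ + 2 * Real.pi / β := by positivity
      exact mul_le_mul (mul_le_mul_of_nonneg_right (mul_le_mul_of_nonneg_right
        (mul_le_mul_of_nonneg_left hLG (by norm_num)) hBW) h44) hmesh hm0 (by positivity)
    have heq : 8 * (16 * (ℓ + 8 * MF) / Λ ^ 6) * BW * (4 * Λ) ^ 4 * (12 * Λ) = 393216 * (ℓ + 8 * MF) * BW / Λ := by
      field_simp; ring
    rw [heq] at hstep
    calc 8 * (LF / (Λ / 2) ^ 4 + 2 * MF / (Λ / 2) ^ 6) * BW * (4 * Λ) ^ 4 * (4 * Λ + 2 * Real.pi / β) / β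
        ≤ (393216 * (ℓ + 8 * MF) * BW / Λ) / β := div_le_div_of_nonneg_right hstep hβ0.le
      _ = 393216 / Real.pi * (ℓ + 8 * MF) * BW * ((Real.pi / β) / Λ) := by field_simp
  rw [h1]
  exact add_le_add le_rfl h2

end SliceBubble

end Summit.HubbardSuperconductivity.HubbardSuperconductivity.Theorems.KLRegimeSplit

end
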